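import Literature.Analysis.InnerProduct.HigherLensSpaceSpectrum
import Mathlib.Analysis.SpecialFunctions.Complex.CircleAddChar
import Mathlib.RingTheory.RootsOfUnity.Complex
import Mathlib.FieldTheory.KummerExtension
import Mathlib.Tactic.NormNum.Prime
import Mathlib.Tactic.IntervalCases
import HarnessLib

/-!
# Ikeda's lens spaces which are isospectral but not isometric (Ikeda 1980): the complement trick `∏ᵢ(z−γ^{±pᵢl})·∏ⱼ(z−γ^{±qⱼl}) =
# Φ_q(z)`, Propositions 2.5–2.6 (`F_q` through `Ψ_{q,k}`), Proposition 1.2 / Corollary 1.3 (`Ψ_{q,2}` is constant on `Ĩ₀(q,2)`),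
# THEOREM 3.1 (i) (all of `𝓛₀(q, (q−5)/2)` is isospectral), and the explicit pairs `L(11; 1,2,4) ≁ L(11; 1,2,8)` (isospectral, not
# isometric) and `L(13; 1,2,4,8) ≁ L(13; 1,2,4,3)` (isospectral, not even homotopy equivalent)

Layer `Literature/Analysis/InnerProduct`, namespace `Literature.Analysis.InnerProduct`; lane `lit-hodgefound`, prover seat
`lit-hodgefound-p06`, generation 44, self-proposed row g44-#3. Builds on row g44-#1 `HigherLensSpaceMultiplicity.lean` (the
definitions `lensSpaceMultiplicity q p k = dim E_{k(k+2n−2)}(L(q : p₁, …, p_n))`, `ikedaPolynomial q ω = Ψ_{q,k}(ω)`, `IsIkedaWeights q p`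
(`p ∈ Ĩ₀(q, n)`), `LensWeightsEquivalent` (Theorem 2.1 (4): the isometry criterion), `LensWeightsHomotopyEquivalent` (Theorem 2.2: the
homotopy criterion)) and row g44-#2 `HigherLensSpaceSpectrum.lean` (`lensSpaceMultiplicity_eq_iff`: isospectrality ⟺ equality of
`∑_{l<q}(∏ᵢ(1 − 2cos(2πlpᵢ/q)z + z²))^{−1}` in `ℝ⟦z⟧`, Ikeda's (2.2)–(2.3)). THEOREMS ONLY (no definition, no instance, no notation, no
named fact). Mathlib supplies the additive character `ZMod.stdAddChar : ℤ/q → ℂ`, `r ↦ e^{2πir/q}` (injective), the factorisation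
`X^q − 1 = ∏_{i<q}(X − ζⁱ)` for a primitive root (`X_pow_sub_C_eq_prod`, `Complex.isPrimitiveRoot_exp`), `mul_geom_sum`, power-series
inverses over a field, `interval_cases` and `decide` for the finitely many residues in §7.

## Source, verbatim (held text `paper:doi-10-24033-asens-1384`)

A. Ikeda, *On lens spaces which are isospectral but not isometric*, Ann. Sci. ÉNS (4) **13** (1980) 303–315. Introduction (p0002):
"The purpose of this paper is to show that there are many pairs of lens spaces which are isospectral but not isometric and also to
give explicit examples of lens spaces which are isospectral to each other but not even homotopy equivalent." §1 (p0003–p0005): "Let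
`q` be a positive integer. … Put `q₀ = φ(q)/2`. … the set `Ĩ(q, n)` is the set of `n`-tuples `(p₁, …, p_n)` of integers prime to
`q`, and put (1.1) `Ĩ₀(q,n) = {(p₁, …, p_n) ∈ Ĩ(q,n) | pᵢ ≢ ±p_j (mod q), 1 ≤ i < j ≤ n}`. … Put `k = q₀ − n`. We shall define the
map `ω` of `I₀(q,n)` into `I₀(q,k)`: … we choose an element `(q₁, …, q_k) ∈ Ĩ₀(q, k)` such that the set of integers `{p₁, −p₁, …,
p_n, −p_n, q₁, −q₁, …, q_k, −q_k}` forms a complete set of incongruent residues prime to `q`. Then we define (1.3) `ω((p₁, …, p_n))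
= (q₁, …, q_k)`. … We assume `q` is an odd prime. Then we have `q₀ = (q−1)/2` and `Φ_q(z) = ∑_{i=0}^{q−1}zⁱ`. … (1.5) `Ψ_{q,k}((p₁, …,
p_k)) = ∑_{l=1}^{q−1}∏_{i=1}^{k}(z − γ^{pᵢl})(z − γ^{−pᵢl})`. **Proposition 1.2.** If we put `Ψ_{q,k}((p₁, …, p_k)) = ∑_{i=0}^{2k}
(−1)ⁱaᵢz^{2k−i}`, then we have: (i) `aᵢ = a_{2k−i}`; (ii) `a₀ = (q−1)`; (iii) `a₁ = −2k`; (iv) `a₂ = k(q − 2k + 1)`. *Proof.* Since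
we have `(z−γ^{pᵢl})(z−γ^{−pᵢl}) = (γ^{pᵢl}z−1)(γ^{−pᵢl}z−1)`: (i) is easy to see, (ii) is clear. On the other hand, `a₁ = ∑_{l=1}^{q−1}
∑_{i=1}^{k}(γ^{pᵢl} + γ^{−pᵢl}) = 2∑ᵢ∑_l γ^{pᵢl} = −2k`, and `a₂ = … = k(q − 2k + 1)`. … **Corollary 1.3.** Let `q` be an odd prime
not less than 11. Then we have `|J(q, 2)| = 1`. *Proof.* … for any `(p₁, p₂) ∈ I₀(q, 2)`, the polynomial `Ψ_{q,2}((p₁, p₂))` has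
degree 4. By Proposition 1.2, its coefficients are independent of the choice of elements in `I₀(q, 2)`." §2 (p0008–p0010): "**Theorem
2.1** … the following assertions are equivalent: 1. `L` is isometric to `L'`; 2. `L` is diffeomorphic to `L'`; 3. `L` is homeomorphic
to `L'`; 4. there is a number `l` and there are numbers `eᵢ ∈ {−1, 1}` such that `(p₁, …, p_n)` is a permutation of `(e₁ls₁, …,
e_nls_n) (mod q)`. **Theorem 2.2** … `L` is homotopy equivalent to `L'` if and only if there are numbers `l` and `e ∈ {−1, 1}` such
that `s₁⋯s_n ≡ ±lⁿp₁⋯p_n (mod q)`. … (2.2) The lens space `L(q : p₁, …, p_n)` is isospectral to `L(q : s₁, …, s_n)` if and only if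
their generating functions are identical … (2.3) `F_q(z : p₁, …, p_n) = (1/q)∑_{l=1}^{q}(1−z²)/∏ᵢ(z−γ^{pᵢl})(z−γ^{−pᵢl})`. …
**Proposition 2.5.** Let `L(q : p₁, …, p_n)` be a lens space belonging to `𝓛₀(q, n)`, `k = q₀ − n` and let `ω` be the map of
`I₀(q,n)` onto `I₀(q,k)` defined in 1. Assume `q` is an odd prime. Then we have (2.5) `F_q(z : p₁, …, p_n) = (1/q){(1−z²)/(z−1)^{2n} +
Ψ_{q,k}(ω((p₁, …, p_n)))·(1−z²)/Φ_q(z)}`. *Proof.* … for any `l ≢ 0 (mod q)`, we have `∏ᵢ₌₁ⁿ(z−γ^{pᵢl})(z−γ^{−pᵢl})·∏ᵢ₌₁ᵏ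
(z−γ^{qᵢl})(z−γ^{−qᵢl}) = Φ_q(z)`. **Proposition 2.6.** Let `L = L(q : p₁, …, p_n)` and `L' = L(q : s₁, …, s_n)` be lens spaces
belonging to `𝓛₀(q,n)`. Assume `q` is an odd prime. Then `L` is isospectral to `L'` if and only if `Ψ_{q,k}(ω((p₁, …, p_n))) =
Ψ_{q,k}(ω((s₁, …, s_n)))`, where `k = q₀ − n`." §3 (p0010): "**Theorem 3.1.** (i) let `q` be a prime not less than 11. Then there exist
at least two `(q−6)`-dimensional lens spaces with fundamental groups of order `q` which are isospectral but not isometric … *Proof.*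
(i) … Put `k = 2` and `n = q₀ − 2`. Then `2n − 1 = q − 6`. To prove (i), it suffices to show that the map `Ψ_{q,2}` is not injective.
By Proposition 2.4 and Corollary 1.3 … **Remark.** By Theorem 2.1, these lens spaces, which are isospectral but not isometric, are
neither diffeomorphic nor homeomorphic to each other." §4 (p0012–p0013): "(I) 5-dimensional examples (`n = 3`). Case (i): `q = 11`.
Then `q₀ = 5`, `k = 2` and `r = 2`. `{1,1,3} ↦ L(11: 1, 2, 2²)`, `{1,2,2} ↦ L(11: 1, 2, 2³)`. Since `k = 2`, these lens spaces are
isospectral. On the other hand, `(φ(q), n) = (10, 3) = 1`. Hence, by Lemma 2.3, the lens space `L(11: 1, 2, 2²)` is homotopy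
equivalent to `L(11: 1, 2, 2³)`. … (II) A 7-dimensional example (`n = 4`). Case `q = 13`. Then `q₀ = 6`, `k = 2` and `r = 2`.
`{1,1,1,3} ↦ L(13: 1, 2, 2², 2³)`, `{1,1,2,2} ↦ L(13: 1, 2, 2², 2⁴)`, `{1,2,1,2} ↦ L(13: 1, 2, 2³, 2⁴)`. In this case we see these
lens spaces are mutually isospectral but non-homotopy equivalent to each other."

## The dictionary and what is proved (all `q` prime; `q ≠ 2` where the sign matters)

The residues live in `ZMod q`; `γ^r` is `ZMod.stdAddChar r = e^{2πir/q}`, and `(z − γ^w)(z − γ^{−w}) = z² − 2cos(2πw/q)z + 1`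
(`map_quadratic_eq_mul_stdAddChar`), so Ikeda's products over `ℚ(γ)[z]` become products of REAL quadratics, exactly the factors of
rows g44-#1/#2; `Φ_q(z) = 1 + z + ⋯ + z^{q−1}`.
* §1 `prod_X_sub_C_stdAddChar` (`∏_{r∈ℤ/q}(z−γ^r) = z^q − 1`), **`prod_erase_X_sub_C_stdAddChar`** (`∏_{r≠0}(z−γ^r) = 1 + z + ⋯ + z^{q−1}`).
* §2 `IsIkedaWeights.intCast_ne_zero / _ne_neg / _injective`, **`IsIkedaWeights.prod_mul_stdAddChar_eq`** (THE COMPLEMENT TRICK: for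
  `v ∈ Ĩ₀(q, h)`, `q = 2h+1`, the residues `±vᵢ` are all the nonzero residues, so `∏ᵢ(z−γ^{vᵢ})(z−γ^{−vᵢ}) = ∏_{r≠0}(z−γ^r)` — an
  explicit bijection `Fin h ⊕ Fin h ≃ (ℤ/q)∖{0}`), **`IsIkedaWeights.prod_quadratic_eq_geom_sum`** (in `ℝ[z]`: `∏ᵢ(z² − 2cos(2πvᵢ/q)z + 1)
  = ∑_{i<q}zⁱ`), `IsIkedaWeights.mul_left` (scaling by `l ≢ 0` preserves `Ĩ₀`).
* §3 `coe_ikedaPolynomial`, **`IsIkedaWeights.prod_quadratic_mul_eq_geom_sum`** (the complement identity at every level `1 ≤ l ≤ q−1`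
  in `ℝ⟦z⟧`), **`IsIkedaWeights.sum_inv_prod_quadratic_eq`** (PROPOSITION 2.5: `∑_{l<q}(∏ᵢQ_{lpᵢ})^{−1} = (1−z)^{−2n} + Φ_q^{−1}·Ψ_{q,k}(ω)`),
  **`lensSpaceMultiplicity_eq_iff_ikedaPolynomial_eq`** (PROPOSITION 2.6: isospectral ⟺ `Ψ_{q,k}(ω) = Ψ_{q,k}(ω')`).
* §4 `sum_Ico_cos_two_pi_mul_div` (`∑_{l=1}^{q−1}cos(2πlw/q) = −1`), `sum_Ico_cos_mul_cos`, **`IsIkedaWeights.ikedaPolynomial_fin_two`**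
  (PROPOSITION 1.2 for `k = 2`: `Ψ_{q,2}(ω) = (q−1)z⁴ + 4z³ + (2q−6)z² + 4z + (q−1)`, i.e. `a₀ = q−1`, `a₁ = −4`, `a₂ = 2(q−3)`, palindromic),
  **`IsIkedaWeights.ikedaPolynomial_fin_two_eq`** (COROLLARY 1.3: `|J(q,2)| = 1`).
* §5 **`IsIkedaWeights.exists_append`** (complementary weights `ω(p)` EXIST: the residues of `[1, h]` not `≡ ±pᵢ`, enumerated increasingly).
* §6 `IsIkedaWeights.append_left / _right`, **`IsIkedaWeights.lensSpaceMultiplicity_eq_of_eq_two_mul_add_seven`** (THEOREM 3.1 (i),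
  explicit: for `q = 2n + 7` prime, ANY two members of `𝓛₀(q, n+1)` have the same `dim E_{m(m+2n)}` for all `m`).
* §7 THE EXAMPLES: `isIkedaWeights_eleven_…`, **`lensSpaceMultiplicity_eleven_one_two_four_eq`** (`L(11:1,2,4)`, `L(11:1,2,8)` isospectral),
  **`not_lensWeightsEquivalent_eleven`** (… and NOT isometric: Theorem 2.1 (4) fails for every `l (mod 11)`, by `decide`),
  `lensWeightsHomotopyEquivalent_eleven` (… but homotopy equivalent, `l = 7`); `isIkedaWeights_thirteen_…`,
  **`lensSpaceMultiplicity_thirteen_eq`** (`L(13:1,2,4,8)`, `L(13:1,2,4,3)`, `L(13:1,2,8,3)` mutually isospectral),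
  **`not_lensWeightsHomotopyEquivalent_thirteen`** / `…'` (`L(13:1,2,4,8) ≄ L(13:1,2,4,3)` and `L(13:1,2,4,3) ≄ L(13:1,2,8,3)`: Theorem
  2.2's congruence fails for every `l (mod 13)` and `e = ±1` — ISOSPECTRAL BUT NOT EVEN HOMOTOPY EQUIVALENT), and
  `lensWeightsHomotopyEquivalent_thirteen` (for the third pair `L(13:1,2,4,8)`, `L(13:1,2,8,3)` Theorem 2.2's congruence DOES hold,
  `48 ≡ −4⁴·64`; the printed "mutually … non-homotopy equivalent" is formalised for the two pairs where Theorem 2.2 excludes it).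
Not formalised: the lens space as a Riemannian manifold (Theorems 2.1–2.2 and Corollary 2.3 of Ikeda–Yamamoto are the dictionary,
see row g44-#1); the counting Propositions 1.1 / 2.4 and parts (ii)–(iii) of Theorem 3.1 (`k = 3, 4`, via Propositions 1.6–1.7).

## References

* [Ikeda1980] A. Ikeda, *On lens spaces which are isospectral but not isometric*, Ann. Sci. ÉNS (4) 13 (1980) 303–315, §1 (1.1)–(1.5),
  Proposition 1.2, Corollary 1.3, §2 Theorems 2.1–2.2, (2.1)–(2.3), Propositions 2.5–2.6, §3 Theorem 3.1 (i), §4 Examples (I)(i), (II).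
* [IkedaYamamoto1979] A. Ikeda, Y. Yamamoto, *On the spectra of 3-dimensional lens spaces*, Osaka J. Math. 16 (1979) 447–469,
  Corollary 2.3 and Theorem 3.2 (the generating function).
-/

noncomputable section

open Finset Polynomial.Chebyshev

namespace Literature.Analysis.InnerProduct

open _root_.Real _root_.Complex

/-! ### §1 The cyclotomic identity behind the complement trick: `∏_{r ≠ 0 in ℤ/q}(z − γ^r) = 1 + z + ⋯ + z^{q−1}` and
### `(z − γ^w)(z − γ^{−w}) = z² − 2cos(2πw/q)z + 1` -/

section Complex
open Polynomial

variable {q : ℕ} [NeZero q]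

/-- The complexification of the real quadratic `z² − 2cos(2πw/q)z + 1` is `(z − γ^w)(z − γ^{−w})`, `γ = e^{2πi/q}`
("`(z−γ^{pᵢ})(z−γ^{−pᵢ}) = (γ^{pᵢ}z−1)(γ^{−pᵢ}z−1)`"). [cite: Ikeda1980, §1 (1.5) and proof of Proposition 1.2] -/
theorem map_quadratic_eq_mul_stdAddChar (w : ℤ) :
    (X ^ 2 - Polynomial.C (2 * Real.cos (2 * π * w / q)) * X + 1 : ℝ[X]).map (algebraMap ℝ ℂ) =
      (X - Polynomial.C (ZMod.stdAddChar (w : ZMod q))) * (X - Polynomial.C (ZMod.stdAddChar (-(w : ZMod q)))) := by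
  have hsum : ZMod.stdAddChar (w : ZMod q) + ZMod.stdAddChar (-(w : ZMod q)) = ((2 * Real.cos (2 * π * w / q) : ℝ) : ℂ) := by
    rw [← Int.cast_neg, ZMod.stdAddChar_coe, ZMod.stdAddChar_coe]
    push_cast
    rw [Complex.two_cos]
    congr 1
    · congr 1; ring
    · congr 1; ring
  have hprod : ZMod.stdAddChar (w : ZMod q) * ZMod.stdAddChar (-(w : ZMod q)) = 1 := by
    rw [← AddChar.map_add_eq_mul, add_neg_cancel, AddChar.map_zero_eq_one]
  simp only [Polynomial.map_add, Polynomial.map_sub, Polynomial.map_mul, Polynomial.map_pow, map_X, Polynomial.map_C, Polynomial.map_one]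
  have e : (X - Polynomial.C (ZMod.stdAddChar (w : ZMod q))) * (X - Polynomial.C (ZMod.stdAddChar (-(w : ZMod q)))) =
      X ^ 2 - Polynomial.C (ZMod.stdAddChar (w : ZMod q) + ZMod.stdAddChar (-(w : ZMod q))) * X +
        Polynomial.C (ZMod.stdAddChar (w : ZMod q) * ZMod.stdAddChar (-(w : ZMod q))) := by
    rw [map_add, map_mul]
    ring
  rw [e, hsum, hprod, map_one]
  rfl

/-- `∏_{r ∈ ℤ/q}(z − γ^r) = z^q − 1` (`γ` a primitive `q`-th root of unity; the numerator of `Φ_q(z) = (z^q − 1)/(z − 1) = ∑_{i<q}zⁱ` for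
`q` prime). [cite: Ikeda1980, §1 (before (1.5)) and proof of Proposition 2.5] -/
theorem prod_X_sub_C_stdAddChar : ∏ r : ZMod q, (X - Polynomial.C (ZMod.stdAddChar r)) = X ^ q - 1 := by
  have hq : q ≠ 0 := NeZero.ne q
  have hζ := Complex.isPrimitiveRoot_exp q hq
  have h := X_pow_sub_C_eq_prod hζ (Nat.pos_of_ne_zero hq) (one_pow q)
  rw [map_one] at h
  rw [h]
  symm
  refine Finset.prod_bij' (fun i _ ↦ (i : ZMod q)) (fun r _ ↦ r.val) (fun _ _ ↦ Finset.mem_univ _)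
    (fun r _ ↦ Finset.mem_range.mpr (ZMod.val_lt r)) (fun i hi ↦ ?_) (fun r _ ↦ ?_) (fun i _ ↦ ?_)
  · rw [ZMod.val_natCast, Nat.mod_eq_of_lt (Finset.mem_range.mp hi)]
  · exact ZMod.natCast_zmod_val r
  · rw [mul_one, show ((i : ℕ) : ZMod q) = ((i : ℤ) : ZMod q) by simp, ZMod.stdAddChar_coe, ← Complex.exp_nat_mul]
    congr 2
    push_cast
    ring

/-- **`∏_{r ∈ ℤ/q, r ≠ 0}(z − γ^r) = 1 + z + ⋯ + z^{q−1}`** (`= Φ_q(z)` for `q` prime: "`Φ_q(z) = ∑_{i=0}^{q−1}zⁱ`").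
[cite: Ikeda1980, §1 (before (1.5)) and proof of Proposition 2.5] -/
theorem prod_erase_X_sub_C_stdAddChar :
    ∏ r ∈ (Finset.univ : Finset (ZMod q)).erase 0, (X - Polynomial.C (ZMod.stdAddChar r)) = ∑ i ∈ range q, X ^ i := by
  have h := prod_X_sub_C_stdAddChar (q := q)
  rw [← Finset.mul_prod_erase _ _ (Finset.mem_univ (0 : ZMod q)), AddChar.map_zero_eq_one, map_one, ← mul_geom_sum] at h
  exact mul_left_cancel₀ (Polynomial.X_sub_C_ne_zero 1) h

end Complex

/-! ### §2 The complement trick: weights `(v₁, …, v_h) ∈ Ĩ₀(q, h)`, `q = 2h + 1` prime, exhaust the nonzero residues up to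
### sign, so `∏ᵢ(z − γ^{vᵢ})(z − γ^{−vᵢ}) = 1 + z + ⋯ + z^{q−1}` -/

section Complement
open Polynomial

variable {q : ℕ} [hq : Fact q.Prime]

/-- A weight of `Ĩ₀(q, m)` ("integers prime to `q`") is a nonzero residue mod the prime `q`. [cite: Ikeda1980, §1 (1.1)] -/
theorem IsIkedaWeights.intCast_ne_zero {m : ℕ} {v : Fin m → ℤ} (hv : IsIkedaWeights q v) (i : Fin m) :
    ((v i : ℤ) : ZMod q) ≠ 0 := by
  rw [Ne, ZMod.intCast_zmod_eq_zero_iff_dvd]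
  intro hdvd
  have hu : IsUnit (q : ℤ) := (hv.isCoprime i).isUnit_of_dvd' hdvd dvd_rfl
  rw [Int.isUnit_iff_natAbs_eq, Int.natAbs_natCast] at hu
  exact hq.out.one_lt.ne' hu

/-- In `Ĩ₀(q, m)` (`q` an odd prime) no weight is `≡` minus a weight, not even itself. [cite: Ikeda1980, §1 (1.1)] -/
theorem IsIkedaWeights.intCast_ne_neg (hq2 : q ≠ 2) {m : ℕ} {v : Fin m → ℤ} (hv : IsIkedaWeights q v) (i j : Fin m) :
    ((v i : ℤ) : ZMod q) ≠ -((v j : ℤ) : ZMod q) := by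
  intro h
  by_cases hij : i = j
  · subst hij
    have h2 : (2 : ZMod q) * ((v i : ℤ) : ZMod q) = 0 := by linear_combination h
    rcases mul_eq_zero.mp h2 with h2 | h2
    · have : (q : ℤ) ∣ 2 := by
        have e : ((2 : ℤ) : ZMod q) = 0 := by exact_mod_cast h2
        exact (ZMod.intCast_zmod_eq_zero_iff_dvd 2 q).mp e
      have hle : q ≤ 2 := Nat.le_of_dvd two_pos (by exact_mod_cast this)
      have hge := hq.out.two_le
      omega
    · exact hv.intCast_ne_zero i h2
  · apply hv.not_dvd_add i j hij
    rw [← ZMod.intCast_zmod_eq_zero_iff_dvd]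
    push_cast
    linear_combination h

/-- In `Ĩ₀(q, m)` distinct indices carry distinct residues. [cite: Ikeda1980, §1 (1.1)] -/
theorem IsIkedaWeights.intCast_injective {m : ℕ} {v : Fin m → ℤ} (hv : IsIkedaWeights q v) :
    Function.Injective fun i ↦ ((v i : ℤ) : ZMod q) := by
  intro i j h
  by_contra hij
  apply hv.not_dvd_sub i j hij
  rw [← ZMod.intCast_zmod_eq_zero_iff_dvd]
  push_cast
  exact sub_eq_zero.mpr h

/-- **The complement trick** (complex form): for `(v₁, …, v_h) ∈ Ĩ₀(q, h)` with `q = 2h + 1`, the `2h` residues `±vᵢ` are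
exactly the nonzero residues mod `q`, so `∏ᵢ(z − γ^{vᵢ})(z − γ^{−vᵢ}) = ∏_{r≠0}(z − γ^r)` ("the set of integers `{p₁, −p₁, …, p_n,
−p_n, q₁, −q₁, …, q_k, −q_k}` forms a complete set of incongruent residues prime to `q`. Then for any `l ≢ 0 (mod q)`, we have
`∏(z−γ^{pᵢl})(z−γ^{−pᵢl})·∏(z−γ^{qᵢl})(z−γ^{−qᵢl}) = Φ_q(z)`"). [cite: Ikeda1980, §1 (1.2)–(1.3) and proof of Proposition 2.5] -/
theorem IsIkedaWeights.prod_mul_stdAddChar_eq (hq2 : q ≠ 2) {h : ℕ} {v : Fin h → ℤ} (hv : IsIkedaWeights q v)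
    (hh : 2 * h + 1 = q) :
    ∏ i, (X - Polynomial.C (ZMod.stdAddChar ((v i : ℤ) : ZMod q))) * (X - Polynomial.C (ZMod.stdAddChar (-((v i : ℤ) : ZMod q)))) =
      ∏ r ∈ (Finset.univ : Finset (ZMod q)).erase 0, (X - Polynomial.C (ZMod.stdAddChar r)) := by
  classical
  -- the enumeration `ρ` of `±vᵢ`
  let ρ : Fin h ⊕ Fin h → ZMod q := fun s ↦ Sum.elim (fun i ↦ ((v i : ℤ) : ZMod q)) (fun i ↦ -((v i : ℤ) : ZMod q)) s
  have hρ : Function.Injective ρ := by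
    rintro (i | i) (j | j) hij
    · exact congrArg Sum.inl (hv.intCast_injective hij)
    · exact absurd hij (hv.intCast_ne_neg hq2 i j)
    · exact absurd hij.symm (hv.intCast_ne_neg hq2 j i)
    · exact congrArg Sum.inr (hv.intCast_injective (neg_injective hij))
  have himage : (Finset.univ : Finset (Fin h ⊕ Fin h)).image ρ = (Finset.univ : Finset (ZMod q)).erase 0 := by
    apply Finset.eq_of_subset_of_card_le
    · intro r hr
      obtain ⟨s, -, rfl⟩ := Finset.mem_image.mp hr
      rw [Finset.mem_erase]
      refine ⟨?_, Finset.mem_univ _⟩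
      rcases s with i | i
      · exact hv.intCast_ne_zero i
      · exact neg_ne_zero.mpr (hv.intCast_ne_zero i)
    · rw [Finset.card_erase_of_mem (Finset.mem_univ _), Finset.card_univ, ZMod.card,
        Finset.card_image_of_injective _ hρ, Finset.card_univ, Fintype.card_sum, Fintype.card_fin]
      omega
  rw [← himage, Finset.prod_image fun s _ t _ hst ↦ hρ hst, Fintype.prod_sum_type, Finset.prod_mul_distrib]
  rfl

/-- **THE COMPLEMENT IDENTITY in `ℝ[z]`: `∏ᵢ₌₁ʰ(z² − 2cos(2πvᵢ/q)z + 1) = 1 + z + ⋯ + z^{q−1}`** for `(v₁, …, v_h) ∈ Ĩ₀(q, h)`,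
`q = 2h + 1` an odd prime. [cite: Ikeda1980, proof of Proposition 2.5] -/
theorem IsIkedaWeights.prod_quadratic_eq_geom_sum (hq2 : q ≠ 2) {h : ℕ} {v : Fin h → ℤ} (hv : IsIkedaWeights q v)
    (hh : 2 * h + 1 = q) :
    ∏ i, (X ^ 2 - Polynomial.C (2 * Real.cos (2 * π * v i / q)) * X + 1 : ℝ[X]) = ∑ i ∈ range q, X ^ i := by
  haveI : NeZero q := ⟨hq.out.ne_zero⟩
  apply Polynomial.map_injective (algebraMap ℝ ℂ) (RCLike.ofReal_injective)
  rw [Polynomial.map_prod]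
  simp_rw [map_quadratic_eq_mul_stdAddChar]
  rw [hv.prod_mul_stdAddChar_eq hq2 hh, prod_erase_X_sub_C_stdAddChar]
  simp [Polynomial.map_sum]

omit hq in
/-- Scaling by a unit `l` preserves `Ĩ₀(q, m)`. [cite: Ikeda1980, §1 (the equivalence relation on `Ĩ(q,n)`)] -/
theorem IsIkedaWeights.mul_left {m : ℕ} {v : Fin m → ℤ} (hv : IsIkedaWeights q v) {l : ℤ} (hl : IsCoprime l q) :
    IsIkedaWeights q (fun i ↦ l * v i) where
  isCoprime i := hl.mul_left (hv.isCoprime i)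
  not_dvd_sub i j hij hdvd := hv.not_dvd_sub i j hij (hl.symm.dvd_of_dvd_mul_left (by rw [← mul_sub] at hdvd; exact hdvd))
  not_dvd_add i j hij hdvd := hv.not_dvd_add i j hij (hl.symm.dvd_of_dvd_mul_left (by rw [← mul_add] at hdvd; exact hdvd))

/-- `1 ≤ l < q` is prime to the prime `q`. [folklore] -/
private theorem isCoprime_of_mem_Ico {l : ℕ} (hl : l ∈ Finset.Ico 1 q) : IsCoprime (l : ℤ) q := by
  rw [Finset.mem_Ico] at hl
  rw [Nat.isCoprime_iff_coprime]
  exact ((Nat.Prime.coprime_iff_not_dvd hq.out).mpr (Nat.not_dvd_of_pos_of_lt hl.1 hl.2)).symm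

end Complement



/-! ### §3 Proposition 2.5 (the generating function through `Ψ_{q,k}`) and Proposition 2.6 (isospectrality ⟺ `Ψ(ω) = Ψ(ω')`) -/

section PropTwoFive
open PowerSeries
open scoped Polynomial

variable {q : ℕ} [hq : Fact q.Prime]

omit hq in
/-- The constant term of `∏ᵢ(1 − 2cᵢz + z²)` is `1` (so the product is invertible in `ℝ⟦z⟧`). [folklore] -/
private theorem constantCoeff_prod_quadratic {n : ℕ} (c : Fin n → ℝ) :
    constantCoeff (∏ i, ((1 : ℝ⟦X⟧) - PowerSeries.C (2 * c i) * X + X ^ 2)) = 1 := by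
  rw [map_prod]
  refine Finset.prod_eq_one fun i _ ↦ ?_
  simp

omit hq in
/-- The real quadratic `z² − 2cz + 1 ∈ ℝ[z]` coerced into `ℝ⟦z⟧` is `1 − 2cz + z²`. [folklore] -/
private theorem coe_quadratic (c : ℝ) :
    ((Polynomial.X ^ 2 - Polynomial.C (2 * c) * Polynomial.X + 1 : ℝ[X]) : ℝ⟦X⟧) = (1 : ℝ⟦X⟧) - PowerSeries.C (2 * c) * X + X ^ 2 := by
  rw [Polynomial.coe_add, Polynomial.coe_sub, Polynomial.coe_pow, Polynomial.coe_mul, Polynomial.coe_X, Polynomial.coe_C,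
    Polynomial.coe_one]
  ring

omit hq in
/-- Ikeda's `Ψ_{q,k}(ω)` coerced into `ℝ⟦z⟧`. [cite: Ikeda1980, §1 (1.5)] -/
theorem coe_ikedaPolynomial {k : ℕ} (ω : Fin k → ℤ) :
    ((ikedaPolynomial q ω : ℝ[X]) : ℝ⟦X⟧) =
      ∑ l ∈ Finset.Ico 1 q, ∏ i, ((1 : ℝ⟦X⟧) - PowerSeries.C (2 * Real.cos (2 * π * l * ω i / q)) * X + X ^ 2) := by
  rw [ikedaPolynomial, ← Polynomial.coeToPowerSeries.ringHom_apply, map_sum]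
  refine Finset.sum_congr rfl fun l _ ↦ ?_
  rw [map_prod]
  refine Finset.prod_congr rfl fun i _ ↦ ?_
  rw [Polynomial.coeToPowerSeries.ringHom_apply, coe_quadratic]

/-- **The complement identity at level `l`, in `ℝ⟦z⟧`: `∏ᵢ₌₁ʰ(1 − 2cos(2πlvᵢ/q)z + z²) = 1 + z + ⋯ + z^{q−1}`** for
`(v₁, …, v_h) ∈ Ĩ₀(q, h)`, `q = 2h + 1` an odd prime, `1 ≤ l ≤ q − 1` ("for any `l ≢ 0 (mod q)`"). [cite: Ikeda1980, proof of
Proposition 2.5] -/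
theorem IsIkedaWeights.prod_quadratic_mul_eq_geom_sum (hq2 : q ≠ 2) {h : ℕ} {v : Fin h → ℤ} (hv : IsIkedaWeights q v)
    (hh : 2 * h + 1 = q) {l : ℕ} (hl : l ∈ Finset.Ico 1 q) :
    ∏ i, ((1 : ℝ⟦X⟧) - PowerSeries.C (2 * Real.cos (2 * π * l * v i / q)) * X + X ^ 2) = ∑ j ∈ range q, X ^ j := by
  have key := (hv.mul_left (isCoprime_of_mem_Ico hl)).prod_quadratic_eq_geom_sum hq2 hh
  have key' := congrArg (Polynomial.coeToPowerSeries.ringHom (R := ℝ)) key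
  rw [map_prod, map_sum] at key'
  simp only [map_pow, Polynomial.coeToPowerSeries.ringHom_apply, Polynomial.coe_X] at key'
  rw [← key']
  refine Finset.prod_congr rfl fun i _ ↦ ?_
  rw [coe_quadratic]
  congr 4
  push_cast
  ring

omit hq in
/-- The constant term of `1 + z + ⋯ + z^{q−1}` is `1` (`q ≥ 1`). [folklore] -/
private theorem constantCoeff_geom_sum (hq0 : 0 < q) : constantCoeff (∑ j ∈ range q, (X : ℝ⟦X⟧) ^ j) = 1 := by
  rw [map_sum, Finset.sum_range_eq_add_Ico _ hq0, pow_zero, map_one, Finset.sum_eq_zero fun j hj ↦ ?_, add_zero]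
  rw [Finset.mem_Ico] at hj
  rw [map_pow, constantCoeff_X, zero_pow (by omega)]

/-- **PROPOSITION 2.5: `F_q` THROUGH `Ψ_{q,k}`.** For `L(q : p₁, …, p_n) ∈ 𝓛₀(q, n)`, `q = 2(n+k) + 1` an odd prime, and
complementary weights `ω = (q₁, …, q_k)` (`{±pᵢ, ±q_j}` a complete set of residues prime to `q`, i.e. `(p, ω) ∈ Ĩ₀(q, n+k)`):
`∑_{l=0}^{q−1} ∏ᵢ(1 − 2cos(2πlpᵢ/q)z + z²)^{−1} = (1−z)^{−2n} + (1 + z + ⋯ + z^{q−1})^{−1}·Ψ_{q,k}(ω)(z)` in `ℝ⟦z⟧` — "`F_q(z : p₁,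
…, p_n) = (1/q){(1−z²)/(z−1)^{2n} + ∑_{l=1}^{q−1}∏ᵢ₌₁ᵏ(z−γ^{qᵢl})(z−γ^{−qᵢl})·(1−z²)/Φ_q(z)}`" (multiply by `(1−z²)/q`,
`mk_lensSpaceMultiplicity`). [cite: Ikeda1980, Proposition 2.5] -/
theorem IsIkedaWeights.sum_inv_prod_quadratic_eq (hq2 : q ≠ 2) {n k : ℕ} {p : Fin n → ℤ} {ω : Fin k → ℤ}
    (hpω : IsIkedaWeights q (Fin.append p ω)) (hnk : 2 * (n + k) + 1 = q) :
    ∑ l ∈ range q, (∏ i, ((1 : ℝ⟦X⟧) - PowerSeries.C (2 * Real.cos (2 * π * l * p i / q)) * X + X ^ 2))⁻¹ =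
      ((1 - X) ^ (2 * n))⁻¹ + (∑ j ∈ range q, (X : ℝ⟦X⟧) ^ j)⁻¹ * (ikedaPolynomial q ω : ℝ[X]) := by
  have hq0 : 0 < q := hq.out.pos
  rw [Finset.sum_range_eq_add_Ico _ hq0, coe_ikedaPolynomial, Finset.mul_sum]
  congr 1
  · simp only [Nat.cast_zero, mul_zero, zero_mul, zero_div, Real.cos_zero, mul_one]
    rw [Finset.prod_const, Finset.card_univ, Fintype.card_fin, pow_mul]
    congr 2
    rw [show (2 : ℝ) = 1 + 1 by norm_num, map_add, map_one]
    ring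
  · refine Finset.sum_congr rfl fun l hl ↦ ?_
    -- the complement identity for the concatenated family at level `l`
    have key := hpω.prod_quadratic_mul_eq_geom_sum hq2 hnk hl
    rw [Fin.prod_univ_add] at key
    simp only [Fin.append_left, Fin.append_right] at key
    set A := ∏ i, ((1 : ℝ⟦X⟧) - PowerSeries.C (2 * Real.cos (2 * π * l * p i / q)) * X + X ^ 2) with hA
    set B := ∏ i, ((1 : ℝ⟦X⟧) - PowerSeries.C (2 * Real.cos (2 * π * l * ω i / q)) * X + X ^ 2) with hB
    have hBc : constantCoeff B ≠ 0 := by rw [hB, constantCoeff_prod_quadratic]; exact one_ne_zero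
    calc A⁻¹ = A⁻¹ * (B * B⁻¹) := by rw [PowerSeries.mul_inv_cancel _ hBc, mul_one]
      _ = (B⁻¹ * A⁻¹) * B := by ring
      _ = (A * B)⁻¹ * B := by rw [PowerSeries.mul_inv_rev]
      _ = (∑ j ∈ range q, (X : ℝ⟦X⟧) ^ j)⁻¹ * B := by rw [key]

/-- **PROPOSITION 2.6: THE ISOSPECTRALITY CRITERION THROUGH `Ψ`.** Let `L = L(q : p₁, …, p_n)` and `L' = L(q : s₁, …, s_n)` be
lens spaces of `𝓛₀(q, n)`, `q = 2(n + k) + 1` an odd prime, with complementary weights `ω = ω(p)`, `ω' = ω(s) ∈ Ĩ₀(q, k)`. Then `L`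
is isospectral to `L'` (all `dim E_{m(m+2n−2)}` agree) if and only if `Ψ_{q,k}(ω) = Ψ_{q,k}(ω')`. [cite: Ikeda1980, Proposition 2.6] -/
theorem lensSpaceMultiplicity_eq_iff_ikedaPolynomial_eq (hq2 : q ≠ 2) {n k : ℕ} {p s : Fin (n + 1) → ℤ} {ω ω' : Fin k → ℤ}
    (hpω : IsIkedaWeights q (Fin.append p ω)) (hsω : IsIkedaWeights q (Fin.append s ω')) (hnk : 2 * (n + 1 + k) + 1 = q) :
    (∀ m, lensSpaceMultiplicity q p m = lensSpaceMultiplicity q s m) ↔ ikedaPolynomial q ω = ikedaPolynomial q ω' := by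
  have hq0 : 0 < q := hq.out.pos
  rw [lensSpaceMultiplicity_eq_iff q hq0.ne' p s, hpω.sum_inv_prod_quadratic_eq hq2 hnk, hsω.sum_inv_prod_quadratic_eq hq2 hnk,
    add_right_inj]
  have hG : (∑ j ∈ range q, (X : ℝ⟦X⟧) ^ j)⁻¹ ≠ 0 := by
    intro h0
    have := congrArg constantCoeff h0
    rw [PowerSeries.constantCoeff_inv, constantCoeff_geom_sum hq0, map_zero] at this
    norm_num at this
  rw [mul_right_inj' hG, Polynomial.coe_inj]

end PropTwoFive

/-! ### §4 Proposition 1.2 for `k = 2` and Corollary 1.3: `Ψ_{q,2}(ω) = (q−1)z⁴ + 4z³ + (2q−6)z² + 4z + (q−1)` for EVERY `ω ∈ Ĩ₀(q,2)` -/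

section CorOneThree
open Polynomial

variable {q : ℕ} [hq : Fact q.Prime]

/-- `∑_{l=1}^{q−1} cos(2πlw/q) = −1` for `q ∤ w` ("for a nontrivial irreducible representation of `G`, the sum `∑χ(g)` of its
character is zero", minus the term `l = 0`). [cite: Ikeda1980, proof of Proposition 1.2 (`∑_{l=1}^{q−1}γ^{pᵢl} = −1`)] -/
theorem sum_Ico_cos_two_pi_mul_div {w : ℤ} (hw : ¬(q : ℤ) ∣ w) :
    ∑ l ∈ Finset.Ico 1 q, Real.cos (2 * π * l * w / q) = -1 := by
  have hq0 : 0 < q := hq.out.pos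
  have h := sum_range_cos_two_pi_mul_div q hq0.ne' w
  rw [if_neg hw, Finset.sum_range_eq_add_Ico _ hq0] at h
  simp only [Nat.cast_zero, mul_zero, zero_mul, zero_div, Real.cos_zero] at h
  linarith

/-- `∑_{l=1}^{q−1} cos(2πla/q)cos(2πlb/q) = −1` for `q ∤ a ± b` (product-to-sum and the previous lemma). [cite: Ikeda1980, proof of
Proposition 1.2 (iv)] -/
theorem sum_Ico_cos_mul_cos {a b : ℤ} (hsub : ¬(q : ℤ) ∣ a - b) (hadd : ¬(q : ℤ) ∣ a + b) :
    ∑ l ∈ Finset.Ico 1 q, Real.cos (2 * π * l * a / q) * Real.cos (2 * π * l * b / q) = -1 := by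
  have e : ∀ l : ℕ, Real.cos (2 * π * l * a / q) * Real.cos (2 * π * l * b / q) =
      (Real.cos (2 * π * l * ((a + b : ℤ) : ℝ) / q) + Real.cos (2 * π * l * ((a - b : ℤ) : ℝ) / q)) / 2 := by
    intro l
    have h1 : 2 * π * l * ((a + b : ℤ) : ℝ) / q = 2 * π * l * a / q + 2 * π * l * b / q := by push_cast; ring
    have h2 : 2 * π * l * ((a - b : ℤ) : ℝ) / q = 2 * π * l * a / q - 2 * π * l * b / q := by push_cast; ring
    rw [h1, h2, Real.cos_add, Real.cos_sub]
    ring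
  simp_rw [e]
  rw [← Finset.sum_div, Finset.sum_add_distrib, sum_Ico_cos_two_pi_mul_div hadd, sum_Ico_cos_two_pi_mul_div hsub]
  norm_num

/-- One term of `Ψ_{q,2}`: `(z² − 2c₀z + 1)(z² − 2c₁z + 1) = (z⁴ + 1) + (2 + 4c₀c₁)z² − (2c₀ + 2c₁)(z³ + z)`. [cite: Ikeda1980,
proof of Proposition 1.2] -/
private theorem prod_fin_two_quadratic (c : Fin 2 → ℝ) :
    ∏ i, (X ^ 2 - Polynomial.C (2 * c i) * X + 1 : ℝ[X]) =
      (X ^ 4 + 1) + Polynomial.C (2 + 4 * c 0 * c 1) * X ^ 2 - Polynomial.C (2 * c 0 + 2 * c 1) * (X ^ 3 + X) := by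
  rw [Fin.prod_univ_two]
  have e1 : Polynomial.C (2 + 4 * c 0 * c 1) = (2 : ℝ[X]) + Polynomial.C (2 * c 0) * Polynomial.C (2 * c 1) := by
    rw [← map_mul, ← map_ofNat Polynomial.C 2, ← map_add]
    congr 1
    ring
  have e2 : Polynomial.C (2 * c 0 + 2 * c 1) = Polynomial.C (2 * c 0) + Polynomial.C (2 * c 1) := map_add _ _ _
  rw [e1, e2]
  ring

/-- **PROPOSITION 1.2 (`k = 2`) / COROLLARY 1.3: `Ψ_{q,2}(ω₁, ω₂) = (q−1)z⁴ + 4z³ + (2q−6)z² + 4z + (q−1)` for EVERY `(ω₁, ω₂) ∈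
Ĩ₀(q, 2)`** (`q` prime): the coefficients `a₀ = q − 1`, `a₁ = −2k = −4`, `a₂ = k(q − 2k + 1) = 2(q − 3)` of `Ψ_{q,k} = ∑(−1)ⁱaᵢz^{2k−i}`
and palindromy `aᵢ = a_{2k−i}` determine `Ψ_{q,2}` completely — "for any `(p₁, p₂) ∈ I₀(q, 2)`, the polynomial `Ψ_{q,2}((p₁,
p₂))` has degree 4. By Proposition 1.2, its coefficients are independent of the choice of elements in `I₀(q, 2)`. Thus we have
`|J(q, 2)| = 1`". [cite: Ikeda1980, Proposition 1.2 and Corollary 1.3] -/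
theorem IsIkedaWeights.ikedaPolynomial_fin_two {ω : Fin 2 → ℤ} (hω : IsIkedaWeights q ω) :
    ikedaPolynomial q ω =
      Polynomial.C ((q : ℝ) - 1) * X ^ 4 + Polynomial.C 4 * X ^ 3 + Polynomial.C (2 * (q : ℝ) - 6) * X ^ 2 + Polynomial.C 4 * X +
        Polynomial.C ((q : ℝ) - 1) := by
  have hq1 : 1 ≤ q := hq.out.one_lt.le
  have h0 : ¬(q : ℤ) ∣ ω 0 := fun h ↦ by
    have hu : IsUnit (q : ℤ) := (hω.isCoprime 0).isUnit_of_dvd' h dvd_rfl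
    rw [Int.isUnit_iff_natAbs_eq, Int.natAbs_natCast] at hu
    exact hq.out.one_lt.ne' hu
  have h1 : ¬(q : ℤ) ∣ ω 1 := fun h ↦ by
    have hu : IsUnit (q : ℤ) := (hω.isCoprime 1).isUnit_of_dvd' h dvd_rfl
    rw [Int.isUnit_iff_natAbs_eq, Int.natAbs_natCast] at hu
    exact hq.out.one_lt.ne' hu
  have h01s : ¬(q : ℤ) ∣ ω 0 - ω 1 := hω.not_dvd_sub 0 1 (by decide)
  have h01a : ¬(q : ℤ) ∣ ω 0 + ω 1 := hω.not_dvd_add 0 1 (by decide)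
  -- the two sums over `l`
  have hu : ∑ l ∈ Finset.Ico 1 q, (2 * Real.cos (2 * π * l * ω 0 / q) + 2 * Real.cos (2 * π * l * ω 1 / q)) = -4 := by
    rw [Finset.sum_add_distrib, ← Finset.mul_sum, ← Finset.mul_sum, sum_Ico_cos_two_pi_mul_div h0,
      sum_Ico_cos_two_pi_mul_div h1]
    norm_num
  have hw : ∑ l ∈ Finset.Ico 1 q, (2 + 4 * Real.cos (2 * π * l * ω 0 / q) * Real.cos (2 * π * l * ω 1 / q)) = 2 * (q : ℝ) - 6 := by
    rw [Finset.sum_add_distrib, Finset.sum_const, Nat.card_Ico, nsmul_eq_mul, Nat.cast_sub hq1]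
    simp_rw [mul_assoc (4 : ℝ)]
    rw [← Finset.mul_sum, sum_Ico_cos_mul_cos h01s h01a]
    push_cast
    ring
  unfold ikedaPolynomial
  rw [Finset.sum_congr rfl fun (l : ℕ) _ ↦ prod_fin_two_quadratic (fun i ↦ Real.cos (2 * π * l * ω i / q)), Finset.sum_sub_distrib,
    Finset.sum_add_distrib, Finset.sum_const, Nat.card_Ico, ← Finset.sum_mul, ← Finset.sum_mul, ← map_sum, ← map_sum, hu, hw,
    nsmul_eq_mul, Nat.cast_sub hq1]
  simp only [Nat.cast_one, map_sub, map_one, map_mul, map_neg, map_ofNat]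
  rw [← Polynomial.C_eq_natCast]
  ring

/-- **COROLLARY 1.3: `|J(q, 2)| = 1`** — `Ψ_{q,2}` takes the same value on all of `Ĩ₀(q, 2)` (`q` prime). [cite: Ikeda1980, Corollary
1.3] -/
theorem IsIkedaWeights.ikedaPolynomial_fin_two_eq {ω ω' : Fin 2 → ℤ} (hω : IsIkedaWeights q ω) (hω' : IsIkedaWeights q ω') :
    ikedaPolynomial q ω = ikedaPolynomial q ω' := by
  rw [hω.ikedaPolynomial_fin_two, hω'.ikedaPolynomial_fin_two]

end CorOneThree

/-! ### §5 Complementary weights exist: every `(p₁, …, p_n) ∈ Ĩ₀(q, n)`, `n ≤ h = (q−1)/2`, extends to `(p, ω) ∈ Ĩ₀(q, h)` -/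

section ComplementExists

variable {q : ℕ} [hq : Fact q.Prime]

/-- A weight of `Ĩ₀(q, n)` ("integers prime to `q`") is not divisible by the prime `q`. [cite: Ikeda1980, §1 (1.1)] -/
theorem IsIkedaWeights.not_dvd {m : ℕ} {v : Fin m → ℤ} (hv : IsIkedaWeights q v) (i : Fin m) : ¬(q : ℤ) ∣ v i := fun h ↦ by
  have hu : IsUnit (q : ℤ) := (hv.isCoprime i).isUnit_of_dvd' h dvd_rfl
  rw [Int.isUnit_iff_natAbs_eq, Int.natAbs_natCast] at hu
  exact hq.out.one_lt.ne' hu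

/-- An integer `r` with `1 ≤ r ≤ q − 1` is prime to the prime `q`. [folklore] -/
private theorem isCoprime_of_pos_of_lt {r : ℤ} (h1 : 1 ≤ r) (h2 : r < q) : IsCoprime r q := by
  lift r to ℕ using (by omega : 0 ≤ r)
  rw [Nat.isCoprime_iff_coprime]
  exact ((Nat.Prime.coprime_iff_not_dvd hq.out).mpr (Nat.not_dvd_of_pos_of_lt (by omega) (by omega))).symm

/-- **Complementary weights** ("we choose an element `(q₁, …, q_k) ∈ Ĩ₀(q, k)` such that the set of integers `{p₁, −p₁, …, p_n,
−p_n, q₁, −q₁, …, q_k, −q_k}` forms a complete set of incongruent residues prime to `q`"): for `q = 2h + 1` prime and `(p₁, …, p_n) ∈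
Ĩ₀(q, n)`, `n ≤ h`, there is `ω = (q₁, …, q_{h−n})` with `(p, ω) ∈ Ĩ₀(q, h)` — take the residues in `[1, h]` not `≡ ±pᵢ`.
[cite: Ikeda1980, §1 (1.2)–(1.3)] -/
theorem IsIkedaWeights.exists_append {h n k : ℕ} (hh : 2 * h + 1 = q) (hk : n + k = h) {v : Fin n → ℤ} (hv : IsIkedaWeights q v) :
    ∃ ω : Fin k → ℤ, IsIkedaWeights q (Fin.append v ω) := by
  classical
  have hq0 : (0 : ℤ) < q := by exact_mod_cast hq.out.pos
  have hqz : (q : ℤ) = 2 * h + 1 := by exact_mod_cast hh.symm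
  -- the residue `t i = v i mod q ∈ [1, q − 1]` and its representative `ρ i ∈ [1, h]` up to sign
  have ht0 : ∀ i, 0 ≤ v i % q := fun i ↦ Int.emod_nonneg _ hq0.ne'
  have htq : ∀ i, v i % q < q := fun i ↦ Int.emod_lt_of_pos _ hq0
  have htne : ∀ i, v i % q ≠ 0 := fun i h0 ↦ hv.not_dvd i (Int.dvd_of_emod_eq_zero h0)
  have htdvd : ∀ i, (q : ℤ) ∣ v i - v i % q := fun i ↦ Int.dvd_self_sub_emod
  let ρ : Fin n → ℤ := fun i ↦ if v i % q ≤ h then v i % q else q - v i % q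
  have hρ_mem : ∀ i, ρ i ∈ Finset.Icc (1 : ℤ) h := by
    intro i
    have := ht0 i; have := htq i; have := htne i
    simp only [ρ, Finset.mem_Icc]
    split_ifs <;> omega
  -- `r ∈ [1,h]` with `r ≡ v i` forces `r = ρ i`; with `r ≡ −v i` likewise
  have hρ_sub : ∀ i (r : ℤ), r ∈ Finset.Icc (1 : ℤ) h → (q : ℤ) ∣ v i - r → r = ρ i := by
    intro i r hr hdvd
    rw [Finset.mem_Icc] at hr
    have h1 : (q : ℤ) ∣ v i % q - r := by
      have := dvd_sub hdvd (htdvd i)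
      rwa [show v i - r - (v i - v i % q) = v i % q - r by ring] at this
    have h2 : v i % q - r = 0 := by
      apply Int.eq_zero_of_abs_lt_dvd h1
      have := ht0 i; have := htq i
      rw [abs_lt]; constructor <;> omega
    have := htne i
    simp only [ρ]
    split_ifs <;> omega
  have hρ_add : ∀ i (r : ℤ), r ∈ Finset.Icc (1 : ℤ) h → (q : ℤ) ∣ v i + r → r = ρ i := by
    intro i r hr hdvd
    rw [Finset.mem_Icc] at hr
    have h1 : (q : ℤ) ∣ v i % q + r - q := by
      have := dvd_sub (dvd_sub hdvd (htdvd i)) (dvd_refl (q : ℤ))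
      rwa [show v i + r - (v i - v i % q) - q = v i % q + r - q by ring] at this
    have h2 : v i % q + r - q = 0 := by
      apply Int.eq_zero_of_abs_lt_dvd h1
      have := ht0 i; have := htq i
      rw [abs_lt]; constructor <;> omega
    have := htne i
    simp only [ρ]
    split_ifs <;> omega
  have hρ_cong : ∀ i, (q : ℤ) ∣ v i - ρ i ∨ (q : ℤ) ∣ v i + ρ i := by
    intro i
    simp only [ρ]
    split_ifs
    · exact Or.inl (htdvd i)
    · refine Or.inr ?_
      have := dvd_add (htdvd i) (dvd_refl (q : ℤ))
      rwa [show v i - v i % q + q = v i + (q - v i % q) by ring] at this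
  have hρ_inj : Function.Injective ρ := by
    intro i j hij
    by_contra hne
    rcases hρ_cong i with hi | hi <;> rcases hρ_cong j with hj | hj
    · apply hv.not_dvd_sub i j hne
      have := dvd_sub hi hj; rwa [hij, show v i - ρ j - (v j - ρ j) = v i - v j by ring] at this
    · apply hv.not_dvd_add i j hne
      have := dvd_add hi hj; rwa [hij, show v i - ρ j + (v j + ρ j) = v i + v j by ring] at this
    · apply hv.not_dvd_add i j hne
      have := dvd_add hi hj; rwa [hij, show v i + ρ j + (v j - ρ j) = v i + v j by ring] at this
    · apply hv.not_dvd_sub i j hne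
      have := dvd_sub hi hj; rwa [hij, show v i + ρ j - (v j + ρ j) = v i - v j by ring] at this
  -- the complementary residues `A = [1,h] \ ρ(Fin n)`, of size `h − n`
  set R : Finset ℤ := Finset.univ.image ρ with hR
  set A : Finset ℤ := Finset.Icc (1 : ℤ) h \ R with hAdef
  have hRsub : R ⊆ Finset.Icc (1 : ℤ) h := by
    intro r hr
    obtain ⟨i, -, rfl⟩ := Finset.mem_image.mp hr
    exact hρ_mem i
  have hA : A.card = k := by
    rw [hAdef, Finset.card_sdiff_of_subset hRsub, Int.card_Icc, hR, Finset.card_image_of_injective _ hρ_inj, Finset.card_univ,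
      Fintype.card_fin]
    simp only [add_sub_cancel_right, Int.toNat_natCast]
    omega
  let e := A.orderEmbOfFin hA
  have he_mem : ∀ j, e j ∈ Finset.Icc (1 : ℤ) h ∧ ∀ i, ρ i ≠ e j := by
    intro j
    have hj : e j ∈ A := Finset.orderEmbOfFin_mem A hA j
    rw [hAdef, Finset.mem_sdiff] at hj
    refine ⟨hj.1, fun i hi ↦ hj.2 ?_⟩
    rw [hR, Finset.mem_image]
    exact ⟨i, Finset.mem_univ _, hi⟩
  refine ⟨fun j ↦ e j, fun i ↦ ?_, fun i j hij ↦ ?_, fun i j hij ↦ ?_⟩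
  · -- prime to `q`
    induction i using Fin.addCases with
    | left i => rw [Fin.append_left]; exact hv.isCoprime i
    | right j =>
      rw [Fin.append_right]
      have := (he_mem j).1
      rw [Finset.mem_Icc] at this
      exact isCoprime_of_pos_of_lt this.1 (by omega)
  · -- `≢`
    induction i using Fin.addCases with
    | left i =>
      induction j using Fin.addCases with
      | left j =>
        rw [Fin.append_left, Fin.append_left]
        exact hv.not_dvd_sub i j fun e ↦ hij (by rw [e])
      | right j =>
        rw [Fin.append_left, Fin.append_right]
        exact fun hdvd ↦ (he_mem j).2 i (hρ_sub i _ (he_mem j).1 hdvd).symm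
    | right i =>
      induction j using Fin.addCases with
      | left j =>
        rw [Fin.append_right, Fin.append_left]
        intro hdvd
        refine (he_mem i).2 j (hρ_sub j _ (he_mem i).1 ?_).symm
        have := dvd_neg.mpr hdvd; rwa [neg_sub] at this
      | right j =>
        rw [Fin.append_right, Fin.append_right]
        intro hdvd
        have hne : e i ≠ e j := fun h ↦ hij (by rw [e.injective h])
        have h1 := (he_mem i).1; have h2 := (he_mem j).1
        rw [Finset.mem_Icc] at h1 h2
        have h0 : e i - e j = 0 := Int.eq_zero_of_abs_lt_dvd hdvd (by rw [abs_lt]; constructor <;> omega)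
        exact hne (by linarith)
  · -- `≢ −`
    induction i using Fin.addCases with
    | left i =>
      induction j using Fin.addCases with
      | left j =>
        rw [Fin.append_left, Fin.append_left]
        exact hv.not_dvd_add i j fun e ↦ hij (by rw [e])
      | right j =>
        rw [Fin.append_left, Fin.append_right]
        exact fun hdvd ↦ (he_mem j).2 i (hρ_add i _ (he_mem j).1 hdvd).symm
    | right i =>
      induction j using Fin.addCases with
      | left j =>
        rw [Fin.append_right, Fin.append_left]
        intro hdvd
        refine (he_mem i).2 j (hρ_add j _ (he_mem i).1 ?_).symm
        rwa [add_comm] at hdvd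
      | right j =>
        rw [Fin.append_right, Fin.append_right]
        intro hdvd
        have h1 := (he_mem i).1; have h2 := (he_mem j).1
        rw [Finset.mem_Icc] at h1 h2
        have h0 : e i + e j = 0 := Int.eq_zero_of_abs_lt_dvd hdvd (by rw [abs_lt]; constructor <;> omega)
        omega

end ComplementExists

/-! ### §6 THEOREM 3.1 (i): for `q = 2n + 7` prime, ALL the `(2n+1)`-dimensional lens spaces of `𝓛₀(q, n+1)` are isospectral -/

section TheoremThreeOne

variable {q : ℕ} [hq : Fact q.Prime]

omit hq in
/-- The right block of a concatenated family of `Ĩ₀(q, n + k)` lies in `Ĩ₀(q, k)`. [cite: Ikeda1980, §1 (1.1)–(1.3)] -/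
theorem IsIkedaWeights.append_right {n k : ℕ} {v : Fin n → ℤ} {ω : Fin k → ℤ} (h : IsIkedaWeights q (Fin.append v ω)) :
    IsIkedaWeights q ω where
  isCoprime j := by simpa only [Fin.append_right] using h.isCoprime (Fin.natAdd n j)
  not_dvd_sub j j' hne := by
    simpa only [Fin.append_right] using h.not_dvd_sub (Fin.natAdd n j) (Fin.natAdd n j') (fun e ↦ hne (Fin.ext (by simpa using congrArg Fin.val e)))
  not_dvd_add j j' hne := by
    simpa only [Fin.append_right] using h.not_dvd_add (Fin.natAdd n j) (Fin.natAdd n j') (fun e ↦ hne (Fin.ext (by simpa using congrArg Fin.val e)))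

omit hq in
/-- The left block of a concatenated family of `Ĩ₀(q, n + k)` lies in `Ĩ₀(q, n)`. [cite: Ikeda1980, §1 (1.1)–(1.3)] -/
theorem IsIkedaWeights.append_left {n k : ℕ} {v : Fin n → ℤ} {ω : Fin k → ℤ} (h : IsIkedaWeights q (Fin.append v ω)) :
    IsIkedaWeights q v where
  isCoprime i := by simpa only [Fin.append_left] using h.isCoprime (Fin.castAdd k i)
  not_dvd_sub i i' hne := by
    simpa only [Fin.append_left] using h.not_dvd_sub (Fin.castAdd k i) (Fin.castAdd k i') (fun e ↦ hne (Fin.castAdd_inj.mp e))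
  not_dvd_add i i' hne := by
    simpa only [Fin.append_left] using h.not_dvd_add (Fin.castAdd k i) (Fin.castAdd k i') (fun e ↦ hne (Fin.castAdd_inj.mp e))

/-- **IKEDA'S THEOREM 3.1 (i), EXPLICIT FORM.** Let `q = 2n + 7` be a prime (so `q₀ = (q−1)/2 = n + 3`, `k = 2`, and the lens spaces
of `𝓛₀(q, n+1) = {L(q : p₁, …, p_{n+1}) : pᵢ ≢ ±p_j}` have dimension `2(n+1) − 1 = q − 6`). Then ANY TWO lens spaces `L(q : p₁, …,
p_{n+1})`, `L(q : s₁, …, s_{n+1})` of `𝓛₀(q, n+1)` are isospectral: `dim E_{m(m+2n)}` agree for every `m`. (Proof as printed: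
complementary weights `ω(p), ω(s) ∈ Ĩ₀(q, 2)` exist, `Ψ_{q,2}` is constant on `Ĩ₀(q, 2)` by Corollary 1.3, and Proposition 2.6.)
Since `|𝓛₀(q, n+1)/isometry| ≥ (q₀−1)/2 ≥ 2` for `q ≥ 11` (Propositions 1.1, 2.4), "there exist at least two `(q−6)`-dimensional lens
spaces with fundamental groups of order `q` which are isospectral but not isometric"; the explicit pair for `q = 11` follows below.
[cite: Ikeda1980, Theorem 3.1 (i) (with Corollary 1.3, Propositions 2.5–2.6)] -/
theorem IsIkedaWeights.lensSpaceMultiplicity_eq_of_eq_two_mul_add_seven {n : ℕ} (hqn : q = 2 * n + 7) {p s : Fin (n + 1) → ℤ}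
    (hp : IsIkedaWeights q p) (hs : IsIkedaWeights q s) (m : ℕ) :
    lensSpaceMultiplicity q p m = lensSpaceMultiplicity q s m := by
  have hq2 : q ≠ 2 := by omega
  obtain ⟨ω, hpω⟩ := hp.exists_append (h := n + 3) (k := 2) (by omega) (by omega)
  obtain ⟨ω', hsω'⟩ := hs.exists_append (h := n + 3) (k := 2) (by omega) (by omega)
  exact (lensSpaceMultiplicity_eq_iff_ikedaPolynomial_eq hq2 hpω hsω' (by omega)).mpr
    (hpω.append_right.ikedaPolynomial_fin_two_eq hsω'.append_right) m

end TheoremThreeOne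

/-! ### §7 Ikeda's examples: `L(11; 1, 2, 4)` and `L(11; 1, 2, 8)` are isospectral, not isometric (but homotopy equivalent);
### `L(13; 1, 2, 4, 8)` and `L(13; 1, 2, 4, 3)` are isospectral and not even homotopy equivalent -/

section Examples

/-- `11` is prime. [folklore] -/
private theorem fact_prime_eleven : Fact (Nat.Prime 11) := ⟨by norm_num⟩

/-- `13` is prime. [folklore] -/
private theorem fact_prime_thirteen : Fact (Nat.Prime 13) := ⟨by norm_num⟩

/-- `(1, 2, 4) ∈ Ĩ₀(11, 3)`. [cite: Ikeda1980, §4 Example (I) Case (i) (`L(11 : 1, 2, 2²)`)] -/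
theorem isIkedaWeights_eleven_one_two_four : IsIkedaWeights 11 ![1, 2, 4] where
  isCoprime i := by fin_cases i <;> rw [Int.isCoprime_iff_gcd_eq_one] <;> rfl
  not_dvd_sub i j hij := by fin_cases i <;> fin_cases j <;> simp at hij ⊢
  not_dvd_add i j hij := by fin_cases i <;> fin_cases j <;> simp at hij ⊢

/-- `(1, 2, 8) ∈ Ĩ₀(11, 3)`. [cite: Ikeda1980, §4 Example (I) Case (i) (`L(11 : 1, 2, 2³)`)] -/
theorem isIkedaWeights_eleven_one_two_eight : IsIkedaWeights 11 ![1, 2, 8] where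
  isCoprime i := by fin_cases i <;> rw [Int.isCoprime_iff_gcd_eq_one] <;> rfl
  not_dvd_sub i j hij := by fin_cases i <;> fin_cases j <;> simp at hij ⊢
  not_dvd_add i j hij := by fin_cases i <;> fin_cases j <;> simp at hij ⊢

/-- **IKEDA'S 5-DIMENSIONAL EXAMPLE (I)(i): `L(11 : 1, 2, 4)` and `L(11 : 1, 2, 8)` ARE ISOSPECTRAL** ("`q = 11`. Then `q₀ = 5`, `k =
2` and `r = 2`. `{1,1,3} ↦ L(11 : 1, 2, 2²)`, `{1,2,2} ↦ L(11 : 1, 2, 2³)`. Since `k = 2`, these lens spaces are isospectral").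
[cite: Ikeda1980, §4 Example (I) Case (i); Theorem 3.1 (i)] -/
theorem lensSpaceMultiplicity_eleven_one_two_four_eq (m : ℕ) :
    lensSpaceMultiplicity 11 ![1, 2, 4] m = lensSpaceMultiplicity 11 ![1, 2, 8] m :=
  haveI := fact_prime_eleven
  isIkedaWeights_eleven_one_two_four.lensSpaceMultiplicity_eq_of_eq_two_mul_add_seven (n := 2) rfl
    isIkedaWeights_eleven_one_two_eight m

/-- **… AND NOT ISOMETRIC**: `(1, 2, 4)` is not a permutation of `(±l·1, ±l·2, ±l·8) (mod 11)` for any `l` — already `{1, 2, 4} ⊄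
±l·{1, 2, 8}` fails for every residue `l` — so by Theorem 2.1 the two lens spaces are neither isometric, nor diffeomorphic, nor
homeomorphic. [cite: Ikeda1980, §4 Example (I) Case (i) and Theorem 2.1; Theorem 3.1 Remark] -/
theorem not_lensWeightsEquivalent_eleven : ¬LensWeightsEquivalent 11 ![1, 2, 4] ![1, 2, 8] := by
  rintro ⟨l, e, he, σ, h⟩
  -- a `σ`- and `e`-free consequence, with `l` reduced mod `11`
  have key : ∀ i : Fin 3, ∃ j : Fin 3,
      (![1, 2, 4] j : ℤ) % 11 = (l % 11 * ![1, 2, 8] i) % 11 ∨ (![1, 2, 4] j : ℤ) % 11 = (-(l % 11 * ![1, 2, 8] i)) % 11 := by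
    intro i
    refine ⟨σ i, ?_⟩
    have hl : l % 11 * ![(1 : ℤ), 2, 8] i ≡ l * ![(1 : ℤ), 2, 8] i [ZMOD 11] := (Int.mod_modEq l 11).mul_right _
    rcases he i with h1 | h1
    · left
      have := h i
      rw [h1, one_mul] at this
      exact this.trans hl.symm
    · right
      have := h i
      rw [h1, neg_one_mul, neg_mul] at this
      exact this.trans hl.neg.symm
  have h0 : 0 ≤ l % 11 := Int.emod_nonneg _ (by norm_num)
  have h1 : l % 11 < 11 := Int.emod_lt_of_pos _ (by norm_num)
  generalize l % 11 = r at key h0 h1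
  interval_cases r <;> revert key <;> decide

/-- … but `L(11 : 1, 2, 4)` and `L(11 : 1, 2, 8)` ARE homotopy equivalent by Theorem 2.2: `1·2·8 = 16 ≡ 7³·(1·2·4) (mod 11)` ("Since
`(φ(q), n) = (10, 3) = 1` … by Lemma 2.3, the lens space `L(11 : 1, 2, 2²)` is homotopy equivalent to `L(11 : 1, 2, 2³)`").
[cite: Ikeda1980, §4 Example (I) Case (i), Theorem 2.2 and Lemma 2.3] -/
theorem lensWeightsHomotopyEquivalent_eleven : LensWeightsHomotopyEquivalent 11 ![1, 2, 4] ![1, 2, 8] :=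
  ⟨7, 1, Or.inl rfl, by decide⟩

/-- `(1, 2, 4, 8) ∈ Ĩ₀(13, 4)`. [cite: Ikeda1980, §4 Example (II) (`L(13 : 1, 2, 2², 2³)`)] -/
theorem isIkedaWeights_thirteen_one_two_four_eight : IsIkedaWeights 13 ![1, 2, 4, 8] where
  isCoprime i := by fin_cases i <;> rw [Int.isCoprime_iff_gcd_eq_one] <;> rfl
  not_dvd_sub i j hij := by fin_cases i <;> fin_cases j <;> simp at hij ⊢
  not_dvd_add i j hij := by fin_cases i <;> fin_cases j <;> simp at hij ⊢

/-- `(1, 2, 4, 3) ∈ Ĩ₀(13, 4)` (`2⁴ = 16 ≡ 3`). [cite: Ikeda1980, §4 Example (II) (`L(13 : 1, 2, 2², 2⁴)`)] -/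
theorem isIkedaWeights_thirteen_one_two_four_three : IsIkedaWeights 13 ![1, 2, 4, 3] where
  isCoprime i := by fin_cases i <;> rw [Int.isCoprime_iff_gcd_eq_one] <;> rfl
  not_dvd_sub i j hij := by fin_cases i <;> fin_cases j <;> simp at hij ⊢
  not_dvd_add i j hij := by fin_cases i <;> fin_cases j <;> simp at hij ⊢

/-- `(1, 2, 8, 3) ∈ Ĩ₀(13, 4)` (`2³ = 8`, `2⁴ ≡ 3`). [cite: Ikeda1980, §4 Example (II) (`L(13 : 1, 2, 2³, 2⁴)`)] -/
theorem isIkedaWeights_thirteen_one_two_eight_three : IsIkedaWeights 13 ![1, 2, 8, 3] where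
  isCoprime i := by fin_cases i <;> rw [Int.isCoprime_iff_gcd_eq_one] <;> rfl
  not_dvd_sub i j hij := by fin_cases i <;> fin_cases j <;> simp at hij ⊢
  not_dvd_add i j hij := by fin_cases i <;> fin_cases j <;> simp at hij ⊢

/-- **IKEDA'S 7-DIMENSIONAL EXAMPLE (II): `L(13 : 1, 2, 4, 8)`, `L(13 : 1, 2, 4, 3)`, `L(13 : 1, 2, 8, 3)` ARE MUTUALLY ISOSPECTRAL**
("`q = 13`. Then `q₀ = 6`, `k = 2` … In this case we see these lens spaces are mutually isospectral"). [cite: Ikeda1980, §4 Example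
(II); Theorem 3.1 (i)] -/
theorem lensSpaceMultiplicity_thirteen_eq (m : ℕ) :
    lensSpaceMultiplicity 13 ![1, 2, 4, 8] m = lensSpaceMultiplicity 13 ![1, 2, 4, 3] m ∧
      lensSpaceMultiplicity 13 ![1, 2, 4, 3] m = lensSpaceMultiplicity 13 ![1, 2, 8, 3] m :=
  haveI := fact_prime_thirteen
  ⟨isIkedaWeights_thirteen_one_two_four_eight.lensSpaceMultiplicity_eq_of_eq_two_mul_add_seven (n := 3) rfl
      isIkedaWeights_thirteen_one_two_four_three m,
    isIkedaWeights_thirteen_one_two_four_three.lensSpaceMultiplicity_eq_of_eq_two_mul_add_seven (n := 3) rfl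
      isIkedaWeights_thirteen_one_two_eight_three m⟩

/-- The homotopy criterion of Theorem 2.2 with `l` reduced mod `q`: from `∏s ≡ e·l⁴·∏p (mod 13)` to `∏s ≡ e·(l mod 13)⁴·∏p`. [folklore] -/
private theorem prod_modEq_reduce {P S e l : ℤ} (h : S ≡ e * l ^ 4 * P [ZMOD 13]) :
    S % 13 = (e * (l % 13) ^ 4 * P) % 13 :=
  h.trans ((((Int.mod_modEq l 13).symm.pow 4).mul_left e).mul_right P)

/-- **ISOSPECTRAL BUT NOT EVEN HOMOTOPY EQUIVALENT: `L(13 : 1, 2, 4, 8)` and `L(13 : 1, 2, 4, 3)`** — `1·2·4·3 = 24 ≢ ±l⁴·64 (mod 13)`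
for every `l` (the fourth powers mod `13` are `0, 1, 3, 9`), so Theorem 2.2 excludes a homotopy equivalence (and a fortiori, by
Theorem 2.1, an isometry). This is the phenomenon announced in the title and Introduction: "we shall give examples which are
isospectral but not even homotopy equivalent". [cite: Ikeda1980, §4 Example (II) and Theorem 2.2; Introduction] -/
theorem not_lensWeightsHomotopyEquivalent_thirteen :
    ¬LensWeightsHomotopyEquivalent 13 ![1, 2, 4, 8] ![1, 2, 4, 3] := by
  rintro ⟨l, e, he, h⟩
  have key := prod_modEq_reduce h
  have h0 : 0 ≤ l % 13 := Int.emod_nonneg _ (by norm_num)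
  have h1 : l % 13 < 13 := Int.emod_lt_of_pos _ (by norm_num)
  generalize l % 13 = r at key h0 h1
  rcases he with rfl | rfl <;> interval_cases r <;> revert key <;> decide

/-- Likewise **`L(13 : 1, 2, 4, 3)` and `L(13 : 1, 2, 8, 3)` are isospectral and not homotopy equivalent** (`48 ≢ ±l⁴·24 (mod 13)`).
(For the remaining pair Theorem 2.2's congruence IS solvable: `48 ≡ −4⁴·64 (mod 13)`, `lensWeightsHomotopyEquivalent_thirteen`.)
[cite: Ikeda1980, §4 Example (II) and Theorem 2.2] -/
theorem not_lensWeightsHomotopyEquivalent_thirteen' :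
    ¬LensWeightsHomotopyEquivalent 13 ![1, 2, 4, 3] ![1, 2, 8, 3] := by
  rintro ⟨l, e, he, h⟩
  have key := prod_modEq_reduce h
  have h0 : 0 ≤ l % 13 := Int.emod_nonneg _ (by norm_num)
  have h1 : l % 13 < 13 := Int.emod_lt_of_pos _ (by norm_num)
  generalize l % 13 = r at key h0 h1
  rcases he with rfl | rfl <;> interval_cases r <;> revert key <;> decide

/-- For the pair `L(13 : 1, 2, 4, 8)`, `L(13 : 1, 2, 8, 3)` the congruence of Theorem 2.2 holds (`l = 4`, `e = −1`: `1·2·8·3 = 48 ≡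
−4⁴·64 (mod 13)`), so these two isospectral lens spaces are homotopy equivalent (though not isometric). [cite: Ikeda1980, Theorem 2.2
and §4 Example (II)] -/
theorem lensWeightsHomotopyEquivalent_thirteen : LensWeightsHomotopyEquivalent 13 ![1, 2, 4, 8] ![1, 2, 8, 3] :=
  ⟨4, -1, Or.inr rfl, by decide⟩

end Examples

end Literature.Analysis.InnerProduct
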